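import Summits.ValiantsHypothesis.ValiantsHypothesis.Theorems.KPlusLogSqLawTropicalBToeplitzTwoPhase

/-!
# Route `KPlusLogSqLaw`, crux `TropicalB` — linear Toeplitz instances: explicit near-unit tilings (competitor permutations)

HONEST FRAMING.  Helper toward the registered stubs `stub_tropThin` / `stub_tropFat` of
`Cruxes/TropicalB/Lines/birth.lean` (crux `Summit.ValiantsHypothesis.ValiantsHypothesis.Theses.KPlusLogSqLaw.TropicalB`,
ledger item `stmt-ValiantsHypothesis-19771`, route `KPlusLogSqLaw`; cell `pub-symmetroid`, seat `val-sym-trop-p3`,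
2026-08-26).  Pure combinatorics of `Fin (n+1)`: four explicit permutations used as equal-penalty COMPETITORS in the
unit-rounding-regime theorem of `…TropicalBToeplitzUnitRegime` (Conjecture T lane).  Nothing here concerns `TropicalB`,
`KPlusLogSqLaw`, `MatrixDescartes` or `VP ≠ VNP`.

WHAT IS HERE (`n` even throughout, positions `0, …, n`).
* `exists_tiling_fix_first` / `exists_tiling_fix_last` — a permutation fixing `0` (resp. `n`) whose other displacements
  are `±1`: the adjacent-transposition tilings `(1 2)(3 4)⋯(n−1 n)` and `(0 1)(2 3)⋯(n−2 n−1)`.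
* `exists_rotTiling_first` / `exists_rotTiling_last` — for even `j`, `2 ≤ j ≤ n − 2`: the block `[0, j]` (resp.
  `[n−j, n]`) rotated by `+1` (one displacement `−j` at the block's top) and adjacent transpositions elsewhere.
Each is given by explicit piecewise-affine position maps with an explicit inverse (`omega` bookkeeping); only the
EXISTENCE statements with the displacement description are exported (no definitions).

References: folklore.
-/

set_option linter.dupNamespace false
set_option autoImplicit false

namespace Summit.ValiantsHypothesis.ValiantsHypothesis.Theorems.KPlusLogSqLaw

open scoped BigOperators
open Finset

section Tilings

variable {n : ℕ}

/-- **Fix-point tiling, fixed point first.**  For even `n` there is a permutation of `Fin (n+1)` fixing `0` whose other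
displacements are `±1` (the adjacent transpositions `(1 2)(3 4)⋯(n−1 n)`). [folklore] -/
theorem exists_tiling_fix_first (hn : Even n) :
    ∃ σ : Equiv.Perm (Fin (n + 1)), ((σ 0 : Fin (n + 1)) : ℕ) = 0 ∧
      ∀ b : Fin (n + 1), (b : ℕ) ≠ 0 → ((σ b : ℤ) - b = 1 ∨ (σ b : ℤ) - b = -1) := by
  obtain ⟨k, hk⟩ := hn
  let F : ℕ → ℕ := fun b => if b = 0 then 0 else if b % 2 = 1 then b + 1 else b - 1
  have hF : ∀ b, b ≤ n → F b ≤ n := by intro b hb; simp only [F]; split_ifs <;> first | contradiction | omega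
  have hFF : ∀ b, b ≤ n → F (F b) = b := by intro b hb; simp only [F]; split_ifs <;> first | contradiction | omega
  refine ⟨⟨fun b => ⟨F b, Nat.lt_succ_of_le (hF b (Nat.le_of_lt_succ b.isLt))⟩,
    fun b => ⟨F b, Nat.lt_succ_of_le (hF b (Nat.le_of_lt_succ b.isLt))⟩,
    fun b => Fin.ext (hFF b (Nat.le_of_lt_succ b.isLt)), fun b => Fin.ext (hFF b (Nat.le_of_lt_succ b.isLt))⟩,
    by simp [F], fun b hb => ?_⟩
  have hb' := Nat.le_of_lt_succ b.isLt
  simp only [Equiv.coe_fn_mk, F, if_neg hb]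
  split_ifs with h
  · left; push_cast; ring
  · right
    have : 1 ≤ (b : ℕ) := Nat.one_le_iff_ne_zero.mpr hb
    push_cast [this]; ring

/-- **Fix-point tiling, fixed point last.**  For even `n` there is a permutation of `Fin (n+1)` fixing `last` whose other
displacements are `±1` (`(0 1)(2 3)⋯(n−2 n−1)`). [folklore] -/
theorem exists_tiling_fix_last (hn : Even n) :
    ∃ σ : Equiv.Perm (Fin (n + 1)), ((σ (Fin.last n) : Fin (n + 1)) : ℕ) = n ∧
      ∀ b : Fin (n + 1), (b : ℕ) ≠ n → ((σ b : ℤ) - b = 1 ∨ (σ b : ℤ) - b = -1) := by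
  obtain ⟨k, hk⟩ := hn
  let F : ℕ → ℕ := fun b => if b = n then n else if b % 2 = 0 then b + 1 else b - 1
  have hF : ∀ b, b ≤ n → F b ≤ n := by intro b hb; simp only [F]; split_ifs <;> first | contradiction | omega
  have hFF : ∀ b, b ≤ n → F (F b) = b := by intro b hb; simp only [F]; split_ifs <;> first | contradiction | omega
  refine ⟨⟨fun b => ⟨F b, Nat.lt_succ_of_le (hF b (Nat.le_of_lt_succ b.isLt))⟩,
    fun b => ⟨F b, Nat.lt_succ_of_le (hF b (Nat.le_of_lt_succ b.isLt))⟩,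
    fun b => Fin.ext (hFF b (Nat.le_of_lt_succ b.isLt)), fun b => Fin.ext (hFF b (Nat.le_of_lt_succ b.isLt))⟩,
    by simp [F], fun b hb => ?_⟩
  have hb' := Nat.le_of_lt_succ b.isLt
  simp only [Equiv.coe_fn_mk, F, if_neg hb]
  split_ifs with h
  · left; push_cast; ring
  · right
    have : 1 ≤ (b : ℕ) := by omega
    push_cast [this]; ring

/-- **Rotation block first, tiling after.**  For even `n` and even `j` with `2 ≤ j ≤ n − 2` there is a permutation of
`Fin (n+1)` rotating the block `[0, j]` by `+1` (so position `j` has displacement `−j`) and pairing the remaining positions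
by adjacent transpositions: exactly one displacement `−j`, all others `±1`. [folklore] -/
theorem exists_rotTiling_first (hn : Even n) {j : ℕ} (hj : Even j) (h2j : 2 ≤ j) (hjn : j + 2 ≤ n) :
    ∃ σ : Equiv.Perm (Fin (n + 1)), (∀ b : Fin (n + 1), (b : ℕ) = j → ((σ b : Fin (n + 1)) : ℕ) = 0) ∧
      ∀ b : Fin (n + 1), (b : ℕ) ≠ j → ((σ b : ℤ) - b = 1 ∨ (σ b : ℤ) - b = -1) := by
  obtain ⟨k, hk⟩ := hn
  obtain ⟨i, hi⟩ := hj
  let F : ℕ → ℕ := fun b => if b < j then b + 1 else if b = j then 0 else if (b - j) % 2 = 1 then b + 1 else b - 1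
  let G : ℕ → ℕ := fun a => if a = 0 then j else if a ≤ j then a - 1 else if (a - j) % 2 = 1 then a + 1 else a - 1
  have hF : ∀ b, b ≤ n → F b ≤ n := by intro b hb; simp only [F]; split_ifs <;> first | contradiction | omega
  have hG : ∀ a, a ≤ n → G a ≤ n := by intro a ha; simp only [G]; split_ifs <;> first | contradiction | omega
  have hGF : ∀ b, b ≤ n → G (F b) = b := by intro b hb; simp only [F, G]; split_ifs <;> first | contradiction | omega
  have hFG : ∀ a, a ≤ n → F (G a) = a := by intro a ha; simp only [F, G]; split_ifs <;> first | contradiction | omega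
  refine ⟨⟨fun b => ⟨F b, Nat.lt_succ_of_le (hF b (Nat.le_of_lt_succ b.isLt))⟩,
    fun a => ⟨G a, Nat.lt_succ_of_le (hG a (Nat.le_of_lt_succ a.isLt))⟩,
    fun b => Fin.ext (hGF b (Nat.le_of_lt_succ b.isLt)), fun a => Fin.ext (hFG a (Nat.le_of_lt_succ a.isLt))⟩,
    fun b hb => by simp [F, hb], fun b hb => ?_⟩
  have hb' := Nat.le_of_lt_succ b.isLt
  simp only [Equiv.coe_fn_mk, F, if_neg hb]
  split_ifs with h h'
  · left; push_cast; ring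
  · left; push_cast; ring
  · right
    have : 1 ≤ (b : ℕ) := by omega
    push_cast [this]; ring

/-- **Tiling first, rotation block last.**  For even `n` and even `j` with `2 ≤ j ≤ n − 2` there is a permutation of
`Fin (n+1)` pairing `[0, n−j−1]` by adjacent transpositions and rotating the block `[n−j, n]` by `+1` (position `n` has
displacement `−j`): exactly one displacement `−j`, all others `±1`. [folklore] -/
theorem exists_rotTiling_last (hn : Even n) {j : ℕ} (hj : Even j) (h2j : 2 ≤ j) (hjn : j + 2 ≤ n) :
    ∃ σ : Equiv.Perm (Fin (n + 1)), ((σ (Fin.last n) : Fin (n + 1)) : ℕ) = n - j ∧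
      ∀ b : Fin (n + 1), (b : ℕ) ≠ n → ((σ b : ℤ) - b = 1 ∨ (σ b : ℤ) - b = -1) := by
  obtain ⟨k, hk⟩ := hn
  obtain ⟨i, hi⟩ := hj
  let F : ℕ → ℕ := fun b => if b + j + 1 ≤ n then (if b % 2 = 0 then b + 1 else b - 1)
    else if b < n then b + 1 else n - j
  let G : ℕ → ℕ := fun a => if a + j + 1 ≤ n then (if a % 2 = 0 then a + 1 else a - 1)
    else if a = n - j then n else a - 1
  have hF : ∀ b, b ≤ n → F b ≤ n := by intro b hb; simp only [F]; split_ifs <;> first | contradiction | omega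
  have hG : ∀ a, a ≤ n → G a ≤ n := by intro a ha; simp only [G]; split_ifs <;> first | contradiction | omega
  have hGF : ∀ b, b ≤ n → G (F b) = b := by intro b hb; simp only [F, G]; split_ifs <;> first | contradiction | omega
  have hFG : ∀ a, a ≤ n → F (G a) = a := by intro a ha; simp only [F, G]; split_ifs <;> first | contradiction | omega
  refine ⟨⟨fun b => ⟨F b, Nat.lt_succ_of_le (hF b (Nat.le_of_lt_succ b.isLt))⟩,
    fun a => ⟨G a, Nat.lt_succ_of_le (hG a (Nat.le_of_lt_succ a.isLt))⟩,
    fun b => Fin.ext (hGF b (Nat.le_of_lt_succ b.isLt)), fun a => Fin.ext (hFG a (Nat.le_of_lt_succ a.isLt))⟩,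
    ?_, fun b hb => ?_⟩
  · simp only [Equiv.coe_fn_mk, F, Fin.val_last]
    split_ifs <;> first | contradiction | omega
  have hb' := Nat.le_of_lt_succ b.isLt
  simp only [Equiv.coe_fn_mk, F]
  split_ifs with h h' h''
  · left; push_cast; ring
  · right
    have : 1 ≤ (b : ℕ) := by omega
    push_cast [this]; ring
  · left; push_cast; ring
  · exfalso; omega


end Tilings

end Summit.ValiantsHypothesis.ValiantsHypothesis.Theorems.KPlusLogSqLaw
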